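import Mathlib
import HarnessLib

/-!
# Discrete Abel summation for `∑_{N ≤ p ≤ X} (c(p)/p) M(⌊X/p⌋)` and the harmonic sum `∑ 1/(k log k)`

Topic `Literature/NumberTheory/LFunctions` (companion of `LogRieszAbelIntegral.lean`; consumed by the
base range `y ≤ x ≤ y²` of the friable Möbius–root sum asymptotics,
`Literature/NumberTheory/Sieve/FriableMoebiusRootSum*.lean`). Everything here is PROVED; no
definitions, no named facts. For a sequence `w : ℕ → ℝ` write `M(V) = ∑_{1 ≤ n ≤ V} w(n)`.

* `abs_sum_weight_mul_sub_sum_le` — **Abel summation against a Chebyshev-type function.** If the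
  weights `c(k)` (think `c(p) = ρ(p) log p` at primes, `0` elsewhere) satisfy
  `|∑_{i ≤ k} (c(i) − 1)| ≤ C₁ k/log² k` for `k ≥ N − 1`, `|M(V)| ≤ B` for all `V`, and
  `∑_{n ≤ X/N} |w(n)| ≤ K`, then
  `|∑_{N ≤ k ≤ X} c(k) M(⌊X/k⌋)/(k log k) − ∑_{N ≤ k ≤ X} M(⌊X/k⌋)/(k log k)| ≤ C₁ (4B + K)/log²(N − 1)`;
* `sum_partialSum_div_eq_sum_mul_sum` — swapping the order of summation (Dirichlet hyperbola):
  `∑_{N ≤ k ≤ X} M(⌊X/k⌋)/(k log k) = ∑_{n ≤ X/N} w(n) ∑_{N ≤ k ≤ X/n} 1/(k log k)`;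
* `abs_sum_inv_mul_log_sub_loglog_le` — `|∑_{N ≤ k ≤ K} 1/(k log k) − (log log (K+1) − log log N)| ≤ 1/((N−1) log(N−1))`.

## References

* H. L. Montgomery, R. C. Vaughan, *Multiplicative Number Theory I*, CUP 2007, §2.1 (summation by
  parts). [MontgomeryVaughan2007]
-/

open Finset Real

noncomputable section

namespace Literature.NumberTheory.LFunctions

namespace HyperbolaAbel

/-! ### Elementary inequalities for `log` -/

/-- `k (log (k+1) − log k) ≤ 1` for `k ≥ 1` (i.e. `log (1 + 1/k) ≤ 1/k`). [folklore] -/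
private theorem mul_log_succ_sub_log_le_one {k : ℕ} (hk : 1 ≤ k) :
    (k : ℝ) * (Real.log (k + 1) - Real.log k) ≤ 1 := by
  have hk' : (1 : ℝ) ≤ k := by exact_mod_cast hk
  have h0 : (0 : ℝ) < k := by linarith
  rw [← Real.log_div (by linarith) h0.ne']
  calc (k : ℝ) * Real.log ((k + 1) / k) ≤ k * ((k + 1) / k - 1) := by
        gcongr; exact Real.log_le_sub_one_of_pos (by positivity)
    _ = 1 := by field_simp; ring

/-- `log k − log (k − 1) ≥ 1/k` for `k ≥ 2`. [folklore] -/
theorem inv_le_log_sub_log {k : ℕ} (hk : 2 ≤ k) :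
    (1 : ℝ) / k ≤ Real.log k - Real.log (k - 1) := by
  have hk' : (2 : ℝ) ≤ k := by exact_mod_cast hk
  have h1 : (0 : ℝ) < k - 1 := by linarith
  have h2 : (0 : ℝ) < k := by linarith
  have := Real.one_sub_inv_le_log_of_pos (x := k / (k - 1)) (div_pos h2 h1)
  rw [Real.log_div h2.ne' h1.ne', inv_div] at this
  calc (1 : ℝ) / k = 1 - (k - 1) / k := by field_simp; ring
    _ ≤ _ := this

/-- `log log (k+1) − log log k ≤ 1/(k log k)` for `k ≥ 2`. [folklore] -/
theorem loglog_succ_sub_loglog_le {k : ℕ} (hk : 2 ≤ k) :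
    Real.log (Real.log (k + 1)) - Real.log (Real.log k) ≤ 1 / (k * Real.log k) := by
  have hk' : (2 : ℝ) ≤ k := by exact_mod_cast hk
  have h0 : (0 : ℝ) < k := by linarith
  have hlogk : 0 < Real.log k := Real.log_pos (by linarith)
  have hlogk1 : 0 < Real.log (k + 1) := Real.log_pos (by linarith)
  have h1 := mul_log_succ_sub_log_le_one (k := k) (by omega)
  rw [← Real.log_div hlogk1.ne' hlogk.ne']
  calc Real.log (Real.log (k + 1) / Real.log k) ≤ Real.log (k + 1) / Real.log k - 1 :=
        Real.log_le_sub_one_of_pos (div_pos hlogk1 hlogk)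
    _ = k * (Real.log (k + 1) - Real.log k) / (k * Real.log k) := by field_simp
    _ ≤ 1 / (k * Real.log k) := by gcongr

/-- `1/(k log k) ≤ log log k − log log (k − 1)` for `k ≥ 3`. [folklore] -/
theorem inv_mul_log_le_loglog_sub_loglog_pred {k : ℕ} (hk : 3 ≤ k) :
    1 / (k * Real.log k) ≤ Real.log (Real.log k) - Real.log (Real.log (k - 1)) := by
  have hk' : (3 : ℝ) ≤ k := by exact_mod_cast hk
  have h0 : (0 : ℝ) < k := by linarith
  have hlogk : 0 < Real.log k := Real.log_pos (by linarith)
  have hlogk1 : 0 < Real.log (k - 1) := Real.log_pos (by linarith)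
  have hA := inv_le_log_sub_log (k := k) (by omega)
  rw [← Real.log_div hlogk.ne' hlogk1.ne']
  calc 1 / (k * Real.log k) = 1 / k / Real.log k := by rw [div_div]
    _ ≤ (Real.log k - Real.log (k - 1)) / Real.log k := by gcongr
    _ = 1 - (Real.log k / Real.log (k - 1))⁻¹ := by rw [inv_div]; field_simp
    _ ≤ Real.log (Real.log k / Real.log (k - 1)) :=
        Real.one_sub_inv_le_log_of_pos (div_pos hlogk hlogk1)

/-- `1/(k log³ k) ≤ (1/log²(k−1) − 1/log² k)/2` for `k ≥ 4` (telescoping majorant). [folklore] -/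
theorem inv_mul_log_pow_three_le {k : ℕ} (hk : 4 ≤ k) :
    1 / (k * Real.log k ^ 3) ≤ (1 / Real.log (k - 1) ^ 2 - 1 / Real.log k ^ 2) / 2 := by
  have hk' : (4 : ℝ) ≤ k := by exact_mod_cast hk
  have h0 : (0 : ℝ) < k := by linarith
  have hb : 0 < Real.log k := Real.log_pos (by linarith)
  have ha : 0 < Real.log (k - 1) := Real.log_pos (by linarith)
  have hab : Real.log (k - 1) ≤ Real.log k := Real.log_le_log (by linarith) (by linarith)
  have hA := inv_le_log_sub_log (k := k) (by omega)
  set a := Real.log (k - 1)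
  set b := Real.log k
  have h2 : 1 / b ^ 3 ≤ (b + a) / (2 * a ^ 2 * b ^ 2) := by
    rw [div_le_div_iff₀ (by positivity) (by positivity)]
    nlinarith [mul_nonneg (mul_nonneg (sub_nonneg.2 hab) (by positivity : (0 : ℝ) ≤ b + 2 * a))
      (sq_nonneg b)]
  calc 1 / (k * b ^ 3) = 1 / k * (1 / b ^ 3) := by rw [one_div_mul_one_div]
    _ ≤ (b - a) * ((b + a) / (2 * a ^ 2 * b ^ 2)) :=
        mul_le_mul hA h2 (by positivity) (by linarith)
    _ = (1 / a ^ 2 - 1 / b ^ 2) / 2 := by field_simp; ring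

/-! ### The harmonic sum `∑ 1/(k log k)` -/

/-- Telescoping over `Ico N X`: `∑_{N ≤ k < X} (f (k+1) − f k) = f X − f N`. [folklore] -/
private theorem sum_Ico_succ_sub (f : ℕ → ℝ) {N X : ℕ} (h : N ≤ X) :
    ∑ k ∈ Ico N X, (f (k + 1) - f k) = f X - f N := by
  induction X, h using Nat.le_induction with
  | base => simp
  | succ X hNX ih => rw [Finset.sum_Ico_succ_top hNX, ih]; ring

/-- **`∑_{N ≤ k ≤ K} 1/(k log k) = log log (K + 1) − log log N + O(1/(N log N))`**, precisely
`|∑_{N ≤ k ≤ K} 1/(k log k) − (log log (K+1) − log log N)| ≤ 1/((N−1) log(N−1))` for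
`4 ≤ N ≤ K + 1`. [folklore] -/
theorem abs_sum_inv_mul_log_sub_loglog_le {N K : ℕ} (hN : 4 ≤ N) (hNK : N ≤ K + 1) :
    |∑ k ∈ Icc N K, 1 / ((k : ℝ) * Real.log k) -
        (Real.log (Real.log (K + 1)) - Real.log (Real.log N))| ≤
      1 / ((N - 1 : ℝ) * Real.log (N - 1)) := by
  have hIcc : Icc N K = Ico N (K + 1) := by
    ext i; simp only [Finset.mem_Icc, Finset.mem_Ico]; omega
  rw [hIcc]
  have hN' : (4 : ℝ) ≤ N := by exact_mod_cast hN
  have hK' : (3 : ℝ) ≤ K := by exact_mod_cast (by omega : 3 ≤ K)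
  have hlow : Real.log (Real.log (K + 1)) - Real.log (Real.log N) ≤
      ∑ k ∈ Ico N (K + 1), 1 / ((k : ℝ) * Real.log k) := by
    have := sum_Ico_succ_sub (fun k : ℕ => Real.log (Real.log k)) hNK
    push_cast at this
    rw [← this]
    exact Finset.sum_le_sum fun k hk =>
      loglog_succ_sub_loglog_le (by simp only [Finset.mem_Ico] at hk; omega)
  have hupp : ∑ k ∈ Ico N (K + 1), 1 / ((k : ℝ) * Real.log k) ≤
      Real.log (Real.log K) - Real.log (Real.log (N - 1)) := by
    have := sum_Ico_succ_sub (fun k : ℕ => Real.log (Real.log (k - 1))) hNK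
    push_cast at this
    simp only [add_sub_cancel_right] at this
    rw [← this]
    exact Finset.sum_le_sum fun k hk =>
      inv_mul_log_le_loglog_sub_loglog_pred (by simp only [Finset.mem_Ico] at hk; omega)
  have hKK1 : Real.log (Real.log K) ≤ Real.log (Real.log (K + 1)) :=
    Real.log_le_log (Real.log_pos (by linarith)) (Real.log_le_log (by linarith) (by linarith))
  have hNN1 : Real.log (Real.log N) - Real.log (Real.log (N - 1)) ≤
      1 / ((N - 1 : ℝ) * Real.log (N - 1)) := by
    have := loglog_succ_sub_loglog_le (k := N - 1) (by omega)
    rw [Nat.cast_sub (by omega : 1 ≤ N), Nat.cast_one, sub_add_cancel] at this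
    exact this
  have hb0 : 0 ≤ 1 / ((N - 1 : ℝ) * Real.log (N - 1)) := by
    have := Real.log_pos (by linarith : (1 : ℝ) < N - 1)
    have : (0 : ℝ) < N - 1 := by linarith
    positivity
  rw [abs_le]
  constructor <;> linarith

/-! ### Swapping the order of summation -/

/-- **Dirichlet's hyperbola swap**: for `1 ≤ N`,
`∑_{N ≤ k ≤ X} M(⌊X/k⌋)/(k log k) = ∑_{n ≤ X/N} w(n) ∑_{N ≤ k ≤ X/n} 1/(k log k)`. [folklore] -/
theorem sum_partialSum_div_eq_sum_mul_sum (w : ℕ → ℝ) {N : ℕ} (hN : 1 ≤ N) (X : ℕ) :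
    ∑ k ∈ Icc N X, (∑ n ∈ Icc 1 (X / k), w n) / ((k : ℝ) * Real.log k) =
      ∑ n ∈ Icc 1 (X / N), w n * ∑ k ∈ Icc N (X / n), 1 / ((k : ℝ) * Real.log k) := by
  simp_rw [Finset.sum_div, Finset.mul_sum]
  have h : ∀ k n, k ∈ Icc N X ∧ n ∈ Icc 1 (X / k) ↔ k ∈ Icc N (X / n) ∧ n ∈ Icc 1 (X / N) := by
    intro k n
    simp only [Finset.mem_Icc]
    constructor
    · rintro ⟨⟨hNk, _⟩, h1n, hnXk⟩
      have hnk : n * k ≤ X := (Nat.le_div_iff_mul_le (by omega)).1 hnXk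
      refine ⟨⟨hNk, (Nat.le_div_iff_mul_le (by omega)).2 (by rw [mul_comm]; exact hnk)⟩, h1n,
        (Nat.le_div_iff_mul_le (by omega)).2 (le_trans (Nat.mul_le_mul_left n hNk) hnk)⟩
    · rintro ⟨⟨hNk, hkXn⟩, h1n, _⟩
      have hkn : k * n ≤ X := (Nat.le_div_iff_mul_le (by omega)).1 hkXn
      exact ⟨⟨hNk, le_trans (Nat.le_mul_of_pos_right k (by omega)) hkn⟩, h1n,
        (Nat.le_div_iff_mul_le (by omega)).2 (by rw [mul_comm]; exact hkn)⟩
  rw [Finset.sum_comm' h]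
  refine Finset.sum_congr rfl fun n _ => Finset.sum_congr rfl fun k _ => ?_
  rw [mul_one_div]

/-! ### Abel summation against a Chebyshev-type function -/

/-- Telescoping the blocks `(X/(k+1), X/k]`: for `1 ≤ N ≤ X`,
`∑_{N ≤ k < X} ∑_{X/(k+1) < n ≤ X/k} f(n) = ∑_{1 < n ≤ X/N} f(n)` (`X/X = 1`). [folklore] -/
theorem sum_Ico_sum_Ioc_div_eq (f : ℕ → ℝ) {N X : ℕ} (hN : 1 ≤ N) (hNX : N ≤ X) :
    ∑ k ∈ Ico N X, ∑ n ∈ Ioc (X / (k + 1)) (X / k), f n = ∑ n ∈ Ioc 1 (X / N), f n := by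
  obtain ⟨d, rfl⟩ : ∃ d, X = N + d := ⟨X - N, by omega⟩
  induction d generalizing N with
  | zero => simp [Nat.div_self (show 0 < N by omega)]
  | succ d ih =>
    rw [Finset.sum_eq_sum_Ico_succ_bot (by omega), show N + (d + 1) = N + 1 + d by ring,
      ih (by omega) (by omega), add_comm, Finset.sum_Ioc_consecutive _ _ _]
    · exact (Nat.le_div_iff_mul_le (by omega)).2 (by omega)
    · exact Nat.div_le_div_left (by omega) (by omega)

/-- **Abel summation against a Chebyshev-type function.** Let `w, c : ℕ → ℝ`, `4 ≤ N ≤ X`,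
`M(V) = ∑_{1 ≤ n ≤ V} w(n)` with `|M(V)| ≤ B` for all `V`, `∑_{n ≤ X/N} |w(n)| ≤ K`, and
`|∑_{i ≤ k} (c(i) − 1)| ≤ C₁ k/log² k` for all `k ≥ N − 1`. Then
`|∑_{N ≤ k ≤ X} c(k) M(⌊X/k⌋)/(k log k) − ∑_{N ≤ k ≤ X} M(⌊X/k⌋)/(k log k)| ≤ C₁(4B + K)/log²(N − 1)`.
(Summation by parts, `Finset.sum_Ioc_by_parts`; the variation of `k ↦ M(⌊X/k⌋)` is controlled
block-wise by `∑ |w|`, that of `1/(k log k)` telescopes.) [cite: MontgomeryVaughan2007, §2.1] -/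
theorem abs_sum_weight_mul_sub_sum_le (w c : ℕ → ℝ) {N X : ℕ} (hN : 4 ≤ N) (hNX : N ≤ X)
    {B K C₁ : ℝ} (hB0 : 0 ≤ B) (hK0 : 0 ≤ K) (hC₁ : 0 ≤ C₁)
    (hB : ∀ V : ℕ, |∑ n ∈ Icc 1 V, w n| ≤ B)
    (hK : ∑ n ∈ Icc 1 (X / N), |w n| ≤ K)
    (hD : ∀ k : ℕ, N - 1 ≤ k → |∑ i ∈ range (k + 1), (c i - 1)| ≤ C₁ * k / Real.log k ^ 2) :
    |∑ k ∈ Icc N X, c k * ((∑ n ∈ Icc 1 (X / k), w n) / ((k : ℝ) * Real.log k)) -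
        ∑ k ∈ Icc N X, (∑ n ∈ Icc 1 (X / k), w n) / ((k : ℝ) * Real.log k)| ≤
      C₁ * (4 * B + K) / Real.log (N - 1) ^ 2 := by
  -- Notation: `F k = M(X/k)/(k log k)`, `g i = c i - 1`, `L = log (N - 1)`.
  set F : ℕ → ℝ := fun k => (∑ n ∈ Icc 1 (X / k), w n) / ((k : ℝ) * Real.log k) with hF
  set g : ℕ → ℝ := fun i => c i - 1 with hg
  have hN' : (4 : ℝ) ≤ N := by exact_mod_cast hN
  have hNX' : (N : ℝ) ≤ X := by exact_mod_cast hNX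
  have hL1 : 1 < Real.log ((N : ℝ) - 1) := by
    rw [Real.lt_log_iff_exp_lt (by linarith)]
    linarith [Real.exp_one_lt_three]
  set L := Real.log ((N : ℝ) - 1) with hLdef
  have hL0 : 0 < L := by linarith
  have hlogN : L ≤ Real.log N := Real.log_le_log (by linarith) (by linarith)
  have hFle : ∀ k : ℕ, N ≤ k → |F k| ≤ B / (k * Real.log k) := by
    intro k hk
    have hk' : (4 : ℝ) ≤ k := by exact_mod_cast le_trans hN hk
    have hpos : 0 < (k : ℝ) * Real.log k := by
      have := Real.log_pos (by linarith : (1 : ℝ) < k); positivity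
    rw [hF]; dsimp only
    rw [abs_div, abs_of_pos hpos]
    exact div_le_div_of_nonneg_right (hB _) hpos.le
  -- Step 1: Abel summation.
  have h1N : N - 1 + 1 = N := by omega
  have hIcc : Icc N X = Ioc (N - 1) X := by
    ext i; simp only [Finset.mem_Icc, Finset.mem_Ioc]; omega
  have hdiff : ∑ k ∈ Icc N X, c k * F k - ∑ k ∈ Icc N X, F k =
      ∑ i ∈ Ioc (N - 1) X, F i • g i := by
    rw [← Finset.sum_sub_distrib, hIcc]
    refine Finset.sum_congr rfl fun i _ => ?_
    simp only [smul_eq_mul, hg]; ring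
  change |∑ k ∈ Icc N X, c k * F k - ∑ k ∈ Icc N X, F k| ≤ _
  rw [hdiff, Finset.sum_Ioc_by_parts F g (by omega : N - 1 < X), h1N]
  -- Step 2: the two boundary terms.
  have ha : |F X • ∑ i ∈ range (X + 1), g i| ≤ C₁ * B / L ^ 2 := by
    have hX' : (4 : ℝ) ≤ X := by exact_mod_cast le_trans hN hNX
    have hlogX : L ≤ Real.log X := Real.log_le_log (by linarith) (by linarith)
    have hX0 : (X : ℝ) ≠ 0 := by exact_mod_cast (show X ≠ 0 by omega)
    have hlX0 : Real.log X ≠ 0 := (Real.log_pos (by linarith)).ne'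
    rw [smul_eq_mul, abs_mul]
    calc |F X| * |∑ i ∈ range (X + 1), g i|
        ≤ B / (X * Real.log X) * (C₁ * X / Real.log X ^ 2) :=
          mul_le_mul (hFle X hNX) (hD X (by omega)) (abs_nonneg _) (by positivity)
      _ = C₁ * B / Real.log X ^ 3 := by field_simp
      _ ≤ C₁ * B / L ^ 2 := by
          apply div_le_div_of_nonneg_left (by positivity) (by positivity)
          calc L ^ 2 ≤ Real.log X ^ 2 := by gcongr
            _ ≤ Real.log X ^ 3 := pow_le_pow_right₀ (by linarith) (by norm_num)
  have hb : |F N • ∑ i ∈ range N, g i| ≤ C₁ * B / L ^ 2 := by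
    have hGN := hD (N - 1) le_rfl
    rw [h1N, Nat.cast_sub (by omega : 1 ≤ N), Nat.cast_one] at hGN
    have hNlog : 0 < (N : ℝ) * Real.log N := mul_pos (by linarith) (by linarith)
    rw [smul_eq_mul, abs_mul]
    calc |F N| * |∑ i ∈ range N, g i| ≤ B / (N * Real.log N) * (C₁ * (N - 1) / L ^ 2) :=
          mul_le_mul (hFle N le_rfl) hGN (abs_nonneg _) (by positivity)
      _ = C₁ * B / L ^ 2 * ((N - 1) / (N * Real.log N)) := by ring
      _ ≤ C₁ * B / L ^ 2 * 1 := by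
          gcongr
          rw [div_le_one hNlog]
          nlinarith
      _ = C₁ * B / L ^ 2 := mul_one _
  -- Step 3: the variation sum.
  have hc : |∑ i ∈ Ioc (N - 1) (X - 1), (F (i + 1) - F i) • ∑ j ∈ range (i + 1), g j| ≤
      C₁ * K / L ^ 2 + C₁ * B / L ^ 2 := by
    have hIco : Ioc (N - 1) (X - 1) = Ico N X := by
      ext i; simp only [Finset.mem_Ioc, Finset.mem_Ico]; omega
    rw [hIco]
    have hIcc1 : ∀ V, Icc 1 V = Ioc 0 V := fun V => by
      ext n; simp only [Finset.mem_Icc, Finset.mem_Ioc]; omega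
    -- per-term bound
    have key : ∀ i ∈ Ico N X, |(F (i + 1) - F i) • ∑ j ∈ range (i + 1), g j| ≤
        C₁ / Real.log N ^ 3 * ∑ n ∈ Ioc (X / (i + 1)) (X / i), |w n| +
          C₁ * B * (1 / Real.log ((i : ℝ) - 1) ^ 2 - 1 / Real.log ((↑(i + 1) : ℝ) - 1) ^ 2) := by
      intro i hi
      rw [Finset.mem_Ico] at hi
      obtain ⟨hNi, hiX⟩ := hi
      have hi' : (4 : ℝ) ≤ i := by exact_mod_cast le_trans hN hNi
      have hNi' : (N : ℝ) ≤ i := by exact_mod_cast hNi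
      have hli : 1 < Real.log i := lt_of_lt_of_le hL1 (Real.log_le_log (by linarith) (by linarith))
      have hlNi : Real.log N ≤ Real.log i := Real.log_le_log (by linarith) hNi'
      have hli1 : Real.log i ≤ Real.log (i + 1) := Real.log_le_log (by linarith) (by linarith)
      have hlNi1 : Real.log N ≤ Real.log (i + 1) := hlNi.trans hli1
      have hi0 : (i : ℝ) ≠ 0 := by exact_mod_cast (show i ≠ 0 by omega)
      have hli0 : Real.log i ≠ 0 := by positivity
      have hli10 : Real.log (i + 1) ≠ 0 := ne_of_gt (by linarith)
      set p : ℝ := i * Real.log i with hp_def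
      set q : ℝ := (i + 1) * Real.log (i + 1) with hq_def
      have hp : 0 < p := by positivity
      have hpq : p ≤ q := by
        simp only [hp_def, hq_def]
        exact mul_le_mul (by linarith) hli1 (by linarith) (by linarith)
      have hq : 0 < q := lt_of_lt_of_le hp hpq
      have hp0 : p ≠ 0 := hp.ne'
      have hq0 : q ≠ 0 := hq.ne'
      have hqp : q - p ≤ 2 * Real.log (i + 1) := by
        have := mul_log_succ_sub_log_le_one (k := i) (by omega)
        simp only [hp_def, hq_def]; nlinarith
      -- the jump of `M(X/·)` across `i → i+1`
      set V : ℝ := ∑ n ∈ Ioc (X / (i + 1)) (X / i), |w n| with hV_def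
      have hM01 : (∑ n ∈ Icc 1 (X / i), w n) - ∑ n ∈ Icc 1 (X / (i + 1)), w n =
          ∑ n ∈ Ioc (X / (i + 1)) (X / i), w n := by
        rw [hIcc1, hIcc1, sub_eq_iff_eq_add', Finset.sum_Ioc_consecutive _ (Nat.zero_le _)
          (Nat.div_le_div_left (Nat.le_succ i) (by omega))]
      have hVi : |(∑ n ∈ Icc 1 (X / (i + 1)), w n) - ∑ n ∈ Icc 1 (X / i), w n| ≤ V := by
        rw [abs_sub_comm, hM01]; exact Finset.abs_sum_le_sum_abs _ _
      have hV0 : 0 ≤ V := le_trans (abs_nonneg _) hVi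
      have hF1 : F (i + 1) = (∑ n ∈ Icc 1 (X / (i + 1)), w n) / q := by
        simp only [hF, hq_def]; push_cast; rfl
      have hFdiff : F (i + 1) - F i =
          ((∑ n ∈ Icc 1 (X / (i + 1)), w n) - ∑ n ∈ Icc 1 (X / i), w n) / q -
            (∑ n ∈ Icc 1 (X / i), w n) * ((q - p) / (p * q)) := by
        rw [hF1, show F i = (∑ n ∈ Icc 1 (X / i), w n) / p from rfl]
        field_simp; ring
      have hFabs : |F (i + 1) - F i| ≤ V / q + B * ((q - p) / (p * q)) := by
        rw [hFdiff]
        refine (abs_sub _ _).trans (add_le_add ?_ ?_)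
        · rw [abs_div, abs_of_pos hq]; exact div_le_div_of_nonneg_right hVi hq.le
        · have h0 : 0 ≤ (q - p) / (p * q) := div_nonneg (sub_nonneg.2 hpq) (by positivity)
          rw [abs_mul, abs_of_nonneg h0]
          exact mul_le_mul_of_nonneg_right (hB _) h0
      have hG := hD i (by omega)
      have h4 := inv_mul_log_pow_three_le (k := i) (by omega)
      have hlN0 : 0 < Real.log N := by linarith
      have h1 : (i : ℝ) / (q * Real.log i ^ 2) ≤ 1 / Real.log N ^ 3 := by
        rw [div_le_div_iff₀ (by positivity) (by positivity), one_mul]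
        calc (i : ℝ) * Real.log N ^ 3 = i * (Real.log N * Real.log N ^ 2) := by ring
          _ ≤ (i + 1) * (Real.log (i + 1) * Real.log i ^ 2) := by gcongr <;> linarith
          _ = q * Real.log i ^ 2 := by simp only [hq_def]; ring
      have h2 : (q - p) * i / (p * q * Real.log i ^ 2) ≤
          1 / Real.log ((i : ℝ) - 1) ^ 2 - 1 / Real.log i ^ 2 :=
        calc (q - p) * i / (p * q * Real.log i ^ 2)
            ≤ 2 * Real.log (i + 1) * i / (p * q * Real.log i ^ 2) := by gcongr
          _ = 2 / ((i + 1) * Real.log i ^ 3) := by simp only [hp_def, hq_def]; field_simp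
          _ ≤ 2 / (i * Real.log i ^ 3) := by gcongr; linarith
          _ ≤ _ := by rw [div_eq_mul_one_div 2]; linarith
      rw [smul_eq_mul, abs_mul]
      calc |F (i + 1) - F i| * |∑ j ∈ range (i + 1), g j|
          ≤ (V / q + B * ((q - p) / (p * q))) * (C₁ * i / Real.log i ^ 2) :=
            mul_le_mul hFabs hG (abs_nonneg _) (le_trans (abs_nonneg _) hFabs)
        _ = C₁ * V * (i / (q * Real.log i ^ 2)) +
              C₁ * B * ((q - p) * i / (p * q * Real.log i ^ 2)) := by ring
        _ ≤ C₁ * V * (1 / Real.log N ^ 3) +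
              C₁ * B * (1 / Real.log ((i : ℝ) - 1) ^ 2 - 1 / Real.log i ^ 2) :=
            add_le_add (mul_le_mul_of_nonneg_left h1 (by positivity))
              (mul_le_mul_of_nonneg_left h2 (by positivity))
        _ = _ := by push_cast; rw [add_sub_cancel_right]; ring
    calc |∑ i ∈ Ico N X, (F (i + 1) - F i) • ∑ j ∈ range (i + 1), g j|
        ≤ ∑ i ∈ Ico N X, |(F (i + 1) - F i) • ∑ j ∈ range (i + 1), g j| :=
          Finset.abs_sum_le_sum_abs _ _
      _ ≤ ∑ i ∈ Ico N X, (C₁ / Real.log N ^ 3 * ∑ n ∈ Ioc (X / (i + 1)) (X / i), |w n| +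
          C₁ * B * (1 / Real.log ((i : ℝ) - 1) ^ 2 - 1 / Real.log ((↑(i + 1) : ℝ) - 1) ^ 2)) :=
          Finset.sum_le_sum key
      _ = C₁ / Real.log N ^ 3 * ∑ n ∈ Ioc 1 (X / N), |w n| +
          C₁ * B * (1 / L ^ 2 - 1 / Real.log ((X : ℝ) - 1) ^ 2) := by
          rw [Finset.sum_add_distrib, ← Finset.mul_sum, ← Finset.mul_sum,
            sum_Ico_sum_Ioc_div_eq _ (by omega) hNX]
          congr 1
          have := sum_Ico_succ_sub (fun k : ℕ => 1 / Real.log ((k : ℝ) - 1) ^ 2) hNX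
          rw [← neg_inj, ← Finset.sum_neg_distrib] at this
          simp only [neg_sub] at this
          rw [this]
      _ ≤ C₁ / Real.log N ^ 3 * K + C₁ * B * (1 / L ^ 2 - 0) := by
          gcongr
          · exact le_trans (Finset.sum_le_sum_of_subset_of_nonneg Finset.Ioc_subset_Icc_self
              (fun _ _ _ => abs_nonneg _)) hK
          · positivity
      _ ≤ C₁ * K / L ^ 2 + C₁ * B / L ^ 2 := by
          have h3 : L ^ 2 ≤ Real.log N ^ 3 :=
            calc L ^ 2 ≤ Real.log N ^ 2 := by gcongr
              _ ≤ Real.log N ^ 3 := pow_le_pow_right₀ (by linarith) (by norm_num)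
          have : C₁ / Real.log N ^ 3 * K ≤ C₁ * K / L ^ 2 := by
            rw [div_mul_eq_mul_div]
            exact div_le_div_of_nonneg_left (by positivity) (by positivity) h3
          rw [sub_zero, ← div_eq_mul_one_div]
          linarith
  -- Step 4: assemble.
  have h0 : 0 ≤ C₁ * B / L ^ 2 := by positivity
  calc _ ≤ |F X • ∑ i ∈ range (X + 1), g i - F N • ∑ i ∈ range N, g i| +
        |∑ i ∈ Ioc (N - 1) (X - 1), (F (i + 1) - F i) • ∑ j ∈ range (i + 1), g j| := abs_sub _ _
    _ ≤ |F X • ∑ i ∈ range (X + 1), g i| + |F N • ∑ i ∈ range N, g i| +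
        |∑ i ∈ Ioc (N - 1) (X - 1), (F (i + 1) - F i) • ∑ j ∈ range (i + 1), g j| := by
          gcongr; exact abs_sub _ _
    _ ≤ C₁ * B / L ^ 2 + C₁ * B / L ^ 2 + (C₁ * K / L ^ 2 + C₁ * B / L ^ 2) := by gcongr
    _ ≤ C₁ * (4 * B + K) / L ^ 2 := by
          rw [show C₁ * (4 * B + K) / L ^ 2 = 4 * (C₁ * B / L ^ 2) + C₁ * K / L ^ 2 by ring]
          linarith

end HyperbolaAbel

end Literature.NumberTheory.LFunctions
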